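/-
Copyright: the b2b-balaban cell (near-miss cell 7), T⁴-continuum CRUX team (coordinator ruling e34b3e0c item (2)),
seat t4-ne7b-formalise-leaf-06 (gen 26). Released under the licence of the surrounding project.
-/
import Summits.QuantumFields.BalabanUV.T4Continuum.Spine.NE7b.LocalPlaquetteExpMoments
import Summits.QuantumFields.YangMills.Theorems.LangevinControlUVFemtoCurvatureTwoPointStubPlaquetteProductRPCS
import Literature.Probability.LatticeModels.ChessboardEstimateEvenTorus
import HarnessLib

/-!
# Local exponential plaquette moments on EVEN tori, `01`-orientation class (route NE7b R-T1, prediction P1-a as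
# worded in `t4/ROUTES-NE7b.md`: «bare Wilson measure on an even torus»)

Cell `pub-balaban`, sub-cell `t4`, spine estimate NE7b (node U5c), candidate route R-T1 of `t4/ROUTES-NE7b.md` v1.
The sibling `…Spine.NE7b.LocalPlaquetteExpMoments` (p249031) proves P1-a on ODD tori for every orientation class via the
odd-torus tilt chessboard. This module proves the same bound on EVEN tori `(ℤ/L)⁴` for the `01`-class, from the tree's
even-torus reflection Cauchy–Schwarz for products of `01`-plaquette observables
(`FemtoCurvatureTwoPoint.stub_plaquetteProductRPCS`, proved) and the abstract even-side chessboard estimate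
`Literature.Probability.LatticeModels.chessboard_le_rpow_even` (Fröhlich–Israel–Lieb–Simon 1978, Thm. 4.1):

* `localExpMoment_class01_even` — for a faithful continuous unitary lattice representation `r` of a compact group `G`
  there is `C ≥ 0` with `∫ exp(a·β·∑_{x∈Q} (N − Re tr r(U_{(x;0,1)}))) dμ_β ≤ exp(C·a·#Q)` for every EVEN `L`
  (`L ≥ 2`), every `β ≥ 4`, every `0 ≤ a ≤ ½` and every finite set of sites `Q`.

(The other five classes on even tori follow by the axis symmetry of Wilson's measure, as in the tree's
`…StubTiltChessboard`; not repeated here.) Everything is proved (kernel; no hypothesis, no `def`).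

HONEST FRAMING: rung 0 of (LS) only (bare measure); (LS) at scales `j ≥ 1` untouched; NE7b
(`T4WeightBudget.RelWeightBound`) NOT PRINTED in [Bałaban 1983–89] and NOT PROVED; spine PROVED 0∕9; rung (B)+1 on a
FINITE torus T⁴ — NOT infinite volume, NOT the mass gap, NOT Clay. HONEST DEPENDENCY: continuum YM on T⁴ ⇐ BetaPertH ∧
nine spine estimates (0/9 proved); BetaPertH ⇐ (D1) ∧ (D4) ∧ CAP+tail; G-an2-4 gates asym, D1 and NE2/3/4.
-/

set_option autoImplicit false

noncomputable section

namespace Summit.QuantumFields.BalabanUV.T4Continuum.NE7b.LocalPlaquetteExpMoments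

open scoped BigOperators
open MeasureTheory Finset
open Literature.MathematicalPhysics.QuantumFieldTheory
open Literature.Barriers.CriticalPhenomena.NonGibbs (symP symM)
open Literature.Probability.LatticeModels (chessboard_le_rpow_even)
open Summit.QuantumFields.YangMills.Theorems.FemtoCurvatureTwoPoint (stub_plaquetteProductRPCS)

variable {G : Type} [Group G] [TopologicalSpace G] [IsTopologicalGroup G] [CompactSpace G]
  [MeasurableSpace G] [BorelSpace G]

section Even

/-- The `01` orientation class. -/
private theorem zero_lt_one_fin4 : ((0 : Fin 4), (1 : Fin 4)).1 < ((0 : Fin 4), (1 : Fin 4)).2 := by decide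

/-- **LOCAL EXPONENTIAL PLAQUETTE MOMENTS ON EVEN TORI, `01`-CLASS (P1-a of route NE7b R-T1 as worded).** For a
faithful continuous unitary lattice representation `r` of a compact group `G` there is `C ≥ 0` such that for every
even torus `(ℤ/L)⁴`, every `β ≥ 4`, every `0 ≤ a ≤ ½` and every finite set of sites `Q`:
`∫ exp(a·β·∑_{x∈Q} (N − Re tr r(U_{(x;0,1)}))) dμ_β ≤ exp(C·a·#Q)`. -/
theorem localExpMoment_class01_even (r : LatticeRep G) :
    ∃ C : ℝ, 0 ≤ C ∧ ∀ (L : ℕ) [NeZero L], Even L → ∀ (β : ℝ), 4 ≤ β → ∀ (a : ℝ), 0 ≤ a → a ≤ 1 / 2 →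
      ∀ (Q : Finset (Site 4 L)),
        ∫ U, Real.exp (a * β * ∑ x ∈ Q, ((r.N : ℝ) - (r.ρ (plaquetteHolonomy U x 0 1)).trace.re))
            ∂(wilsonMeasure r.ρ β : Measure (GaugeConfig 4 L G)) ≤
          Real.exp (C * a * Q.card) := by
  obtain ⟨A, hA0, hA⟩ := exists_log_doubling r
  refine ⟨2 * A, by positivity, fun L _ hL β hβ a ha0 ha Q => ?_⟩
  haveI hprob := isProbabilityMeasure_wilsonMeasure (d := 4) (L := L) (G := G) r.ρ r.continuous β
  have hL1 : 1 ≤ L := Nat.one_le_iff_ne_zero.2 (NeZero.ne L)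
  have hL2 : 2 ≤ L := by
    obtain ⟨m, hm⟩ := hL
    omega
  have hβ0 : 0 ≤ β := by linarith
  have hab : 0 ≤ a * β := mul_nonneg ha0 hβ0
  set μ : Measure (GaugeConfig 4 L G) := wilsonMeasure r.ρ β with hμ
  -- the plaquette energy of the `01`-class and its range
  let P : GaugeConfig 4 L G → Site 4 L → ℝ := fun U x => (r.N : ℝ) - (r.ρ (plaquetteHolonomy U x 0 1)).trace.re
  have hP : ∀ U x, P U x = (r.N : ℝ) - WilsonRP.plaqRe r.ρ U (x, ⟨((0 : Fin 4), (1 : Fin 4)), zero_lt_one_fin4⟩) :=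
    fun U x => rfl
  have hP0 : ∀ U x, 0 ≤ P U x := fun U x => by rw [hP]; exact plaqEnergy_nonneg r.ρ r.continuous U _
  have hP2 : ∀ U x, P U x ≤ 2 * r.N := fun U x => by rw [hP]; exact plaqEnergy_le r.ρ r.continuous U _
  have hPm : ∀ x, Measurable fun U => P U x := fun x =>
    measurable_const.sub (WilsonRP.measurable_plaqRe r.ρ r.continuous (x, ⟨((0 : Fin 4), (1 : Fin 4)), zero_lt_one_fin4⟩))
  -- the truncated exponential `f`, bounded on `ℝ` and equal to `exp(aβ t)` on `[0, 2N]`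
  let f : ℝ → ℝ := fun t => Real.exp (a * β * min t (2 * r.N))
  have hf : Measurable f := Real.measurable_exp.comp ((measurable_id.min measurable_const).const_mul _)
  have hf0 : ∀ t, 0 ≤ f t := fun t => (Real.exp_pos _).le
  have hfM : ∃ M : ℝ, ∀ t, f t ≤ M :=
    ⟨Real.exp (a * β * (2 * r.N)), fun t => Real.exp_le_exp.2 (mul_le_mul_of_nonneg_left (min_le_right _ _) hab)⟩
  have hfP : ∀ U x, f (P U x) = Real.exp (a * β * P U x) := fun U x => by
    simp only [f, min_eq_left (hP2 U x)]
  have hf1 : ∀ U x, 1 ≤ f (P U x) := fun U x => by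
    rw [hfP]; exact Real.one_le_exp (mul_nonneg hab (hP0 U x))
  -- the set function of the chessboard estimate
  set ψ : Finset (Fin 4 → ZMod L) → ℝ := fun S => wilsonExpectation (d := 4) (L := L) r.ρ β
    (fun U => ∏ x ∈ S, f ((r.N : ℝ) - (r.ρ (plaquetteHolonomy U x 0 1)).trace.re)) with hψ
  have hcs := stub_plaquetteProductRPCS G r.N r.ρ r.continuous r.mem_unitary L hL β hβ0 f hf hf0 hfM ψ rfl
  -- the products are bounded measurable, `≥ 1`
  have hprod_meas : ∀ S : Finset (Site 4 L), Measurable fun U : GaugeConfig 4 L G => ∏ x ∈ S, f (P U x) :=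
    fun S => Finset.measurable_prod S fun x _ => hf.comp (hPm x)
  have hprod_bdd : ∀ (S : Finset (Site 4 L)) (U : GaugeConfig 4 L G),
      ∏ x ∈ S, f (P U x) ≤ Real.exp (a * β * (2 * r.N)) ^ S.card := fun S U => by
    rw [← Finset.prod_const]
    exact Finset.prod_le_prod (fun x _ => hf0 _) fun x _ =>
      Real.exp_le_exp.2 (mul_le_mul_of_nonneg_left (min_le_right _ _) hab)
  have hprod_one : ∀ (S : Finset (Site 4 L)) (U : GaugeConfig 4 L G), 1 ≤ ∏ x ∈ S, f (P U x) :=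
    fun S U => calc (1 : ℝ) = ∏ _x ∈ S, (1 : ℝ) := Finset.prod_const_one.symm
      _ ≤ ∏ x ∈ S, f (P U x) := Finset.prod_le_prod (fun _ _ => zero_le_one) fun x _ => hf1 U x
  have hint : ∀ S : Finset (Site 4 L), Integrable (fun U : GaugeConfig 4 L G => ∏ x ∈ S, f (P U x)) μ :=
    fun S => Integrable.of_bound (hprod_meas S).aestronglyMeasurable (Real.exp (a * β * (2 * r.N)) ^ S.card)
      (ae_of_all _ fun U => by
        rw [Real.norm_eq_abs, abs_of_nonneg (zero_le_one.trans (hprod_one S U))]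
        exact hprod_bdd S U)
  have hψS : ∀ S, ψ S = ∫ U, ∏ x ∈ S, f (P U x) ∂μ := fun S => rfl
  have h0 : ∀ S, 0 ≤ ψ S := fun S => by
    rw [hψS]; exact integral_nonneg fun U => zero_le_one.trans (hprod_one S U)
  have hge1 : ∀ S, 1 ≤ ψ S := fun S => by
    rw [hψS]
    calc (1 : ℝ) = ∫ _U, (1 : ℝ) ∂μ := by rw [integral_const, probReal_univ, one_smul]
      _ ≤ ∫ U, ∏ x ∈ S, f (P U x) ∂μ := integral_mono (integrable_const _) (hint S) fun U => hprod_one S U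
  have hempty : ψ ∅ ≤ 1 := by
    rw [hψS]; simp only [Finset.prod_empty, integral_const, probReal_univ, one_smul, le_refl]
  have h1 : 0 < ψ univ := zero_lt_one.trans_le (hge1 _)
  -- the chessboard estimate
  have hchess := chessboard_le_rpow_even (d := 4) (N := L) hL h0 hempty h1 hcs Q
  -- identify `ψ Q` with the integral of the statement and bound `ψ univ`
  have hψQ : ψ Q = ∫ U, Real.exp (a * β * ∑ x ∈ Q, P U x) ∂μ := by
    rw [hψS]
    refine integral_congr_ae (ae_of_all _ fun U => ?_)
    simp only [hfP, Finset.mul_sum, Real.exp_sum]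
  have hψuniv : ψ univ ≤ Real.exp (2 * a * A * (L : ℝ) ^ 4) := by
    rw [hψS]
    have h := integral_exp_class_le_exp r hA hL2 hβ ha0 ha ⟨((0 : Fin 4), (1 : Fin 4)), zero_lt_one_fin4⟩
    refine le_trans (le_of_eq (integral_congr_ae (ae_of_all _ fun U => ?_))) h
    simp only [hfP]
    simp only [hP, Finset.mul_sum, Real.exp_sum]
  -- conclude
  have hL0 : (0 : ℝ) < (L : ℝ) ^ 4 := by positivity
  calc ∫ U, Real.exp (a * β * ∑ x ∈ Q, P U x) ∂μ = ψ Q := hψQ.symm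
    _ ≤ ψ univ ^ ((Q.card : ℝ) / (L : ℝ) ^ 4) := hchess
    _ ≤ Real.exp (2 * a * A * (L : ℝ) ^ 4) ^ ((Q.card : ℝ) / (L : ℝ) ^ 4) :=
        Real.rpow_le_rpow (h0 _) hψuniv (by positivity)
    _ = Real.exp (2 * A * a * Q.card) := by
        rw [← Real.exp_mul]
        congr 1
        calc 2 * a * A * (L : ℝ) ^ 4 * ((Q.card : ℝ) / (L : ℝ) ^ 4)
            = 2 * a * A * Q.card * ((L : ℝ) ^ 4 / (L : ℝ) ^ 4) := by ring
          _ = 2 * A * a * Q.card := by rw [div_self hL0.ne']; ring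

end Even

end Summit.QuantumFields.BalabanUV.T4Continuum.NE7b.LocalPlaquetteExpMoments

end
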